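import Mathlib
import HarnessLib
import Literature.Computability.AlgebraicComplexity.AsymptoticSpectrum
import Literature.Computability.AlgebraicComplexity.BorderRankCW
import Summits.MatrixMultiplication.MatrixMultiplication.Theorems.OutsiderSandwichToricCeiling

/-!
# OutsiderSandwich — no MONOMIAL certificate reaches `⟨8⟩ ⊴ cw₂^{⊠2}`
(decomp-mm lens 4, gen 43, kernel K43-2; THESES-FREE, definition-free, `ω`-free; corollary of
K43-1 `OutsiderSandwichToricCeiling`; helper toward `LaserTangency`, stmt-32268)

WHAT.  K43-1 (`OutsiderSandwichToricCeiling`) showed that neither support frame of `P = cw₂^{⊠2}`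
(Coppersmith–Winograd basis `cwFrame`, diagonalised basis `tightFrame`) admits a combinatorial
degeneration (BCS (15.29)) onto a diagonal of size `≥ 8`.  This file turns that into a NO-GO for
the tree's degeneration-producing device itself.  Every border-subrank / degeneration certificate
on CW powers in the tree (`OutsiderSandwichBorderSubrankSeven`, `…Twenty`, `…MMPlusTwoDegeneration`)
is an instance of `OutsiderSandwichBorderSubrankTwenty.isApproxRestriction_of_monomial`: leg maps
`σA σB σC : Fin r → host indices`, exponents `α β γ : Fin r → ℕ`, an order `K`, and the two
hypotheses (`h₁`) host entries of weight `< K` vanish, (`h₂`) the weight-`K` layer is the target.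

* `cwPow_two_monomial_certificate_le_seven`: for host `kroneckerPow (cwTensor F 2) 2` (any field
  `F`) and target `unitTensor F r`, hypotheses `h₁`, `h₂` VERBATIM as in that lemma force `r ≤ 7`;
* `diagPow_two_monomial_certificate_le_seven`: the same for the host `D ⊠ D`,
  `D a b c = [a, b, c pairwise distinct]` (`≅ cw₂ ⊠ cw₂` over `ℂ`);
* `le_seven_of_frame_certificate`: the frame-level reduction both go through.

So `⟨8⟩ ⊴ cw₂^{⊠2}` — the last open value of `Q̲(cw₂^{⊠2}) ∈ {7, 8}` after `OutsiderSandwichBorder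
SubrankSeven` / `…Ceiling` — is OUT OF REACH of monomial (toric, laser-method) certificates in both
natural bases; closing the gap upward needs a genuinely non-monomial degeneration, closing it
downward needs an invariant finer than the support.

PROOF.  From `h₂` on the diagonal, every `(σA x, σB x, σC x)` is a frame triple of weight `K`.  The
leg maps are injective: if `σA x = σA x'`, compare the weight of `(x', x, x)` with `K` — smaller
contradicts `h₁` (the triple equals the frame triple of `x`), equal contradicts `h₂` (off-diagonal),
larger makes `(x, x', x')` a frame triple of weight `< K`, again contradicting `h₁`.  Hence the image
triples form a diagonal `Ψ` of size `r` inside the frame, and the integer weights `a = α ∘ σA⁻¹`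
(`K+1` off the image), `b = β ∘ σB⁻¹` (`K+1`), `c = γ ∘ σC⁻¹ − K` (`1`) vanish on `Ψ` and are `≥ 1` on
every other frame triple (inside the images by `h₁`/`h₂`, outside because one leg contributes `K+1`
or `1` against `≥ 0`, `≥ 0`, `≥ −K`).  K43-1 then forbids `#Ψ ≥ 8`.

HONEST SCOPE.  A statement about CERTIFICATES (monomial `A(ε), B(ε), C(ε)` in the two bases), not
about `AlgDegeneratesTo (kroneckerPow (cwTensor ℂ 2) 2) (unitTensor ℂ 8)`, which stays open.
-/

set_option linter.dupNamespace false

namespace Summit.MatrixMultiplication.MatrixMultiplication.Theorems.OutsiderSandwichToricCeilingMonomial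

open Finset
open Literature.Computability.AlgebraicComplexity
open Summit.MatrixMultiplication.MatrixMultiplication.Theorems.OutsiderSandwichToricCeiling

/-! ## §1 From a monomial certificate on a frame to a diagonal combinatorial degeneration -/

/-- GENERIC STEP.  Let `Φ` be a frame admitting no diagonal combinatorial degeneration of size
`≥ 8` (integer weights).  If leg maps `τA τB τC : Fin r → Pt` and exponents `α β γ` satisfy the
frame form of the monomial-certificate hypotheses for the target `⟨r⟩` — (`h₁`) no mapped triple of
weight `< K` lies in `Φ`, (`h₂`) a mapped triple lies in `Φ` with weight exactly `K` iff it is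
diagonal — then `r ≤ 7`.  (The maps are forced injective; the image triples form a diagonal; the
weights `α ∘ τA⁻¹` (`K+1` off the image), `β ∘ τB⁻¹` (`K+1`), `γ ∘ τC⁻¹ − K` (`1`) realise it.) [new] -/
theorem le_seven_of_frame_certificate {Φ : Finset Tr}
    (noeight : ∀ (Ψ : Finset Tr) (a b c : Pt → ℤ), Ψ ⊆ Φ →
      (∀ t ∈ Ψ, a t.1 + b t.2.1 + c t.2.2 = 0) → (∀ t ∈ Φ, t ∉ Ψ → 1 ≤ a t.1 + b t.2.1 + c t.2.2) →
      isDiagonal Ψ = true → 8 ≤ #Ψ → False)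
    {r K : ℕ} (τA τB τC : Fin r → Pt) (α β γ : Fin r → ℕ)
    (h₁ : ∀ x y z, α x + β y + γ z < K → (τA x, τB y, τC z) ∉ Φ)
    (h₂ : ∀ x y z, ((τA x, τB y, τC z) ∈ Φ ∧ α x + β y + γ z = K) ↔ (x = y ∧ y = z)) : r ≤ 7 := by
  have diag : ∀ x, (τA x, τB x, τC x) ∈ Φ ∧ α x + β x + γ x = K := fun x => (h₂ x x x).2 ⟨rfl, rfl⟩
  -- the three leg maps are injective
  have iA : Function.Injective τA := by
    intro x x' e
    rcases Nat.lt_trichotomy (α x' + β x + γ x) K with hlt | heq | hgt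
    · exact absurd (e ▸ (diag x).1 : (τA x', τB x, τC x) ∈ Φ) (h₁ x' x x hlt)
    · exact ((h₂ x' x x).1 ⟨by rw [← e]; exact (diag x).1, heq⟩).1.symm
    · have := (diag x).2; have := (diag x').2
      exact absurd (e.symm ▸ (diag x').1 : (τA x, τB x', τC x') ∈ Φ) (h₁ x x' x' (by omega))
  have iB : Function.Injective τB := by
    intro y y' e
    rcases Nat.lt_trichotomy (α y + β y' + γ y) K with hlt | heq | hgt
    · exact absurd (e ▸ (diag y).1 : (τA y, τB y', τC y) ∈ Φ) (h₁ y y' y hlt)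
    · exact ((h₂ y y' y).1 ⟨by rw [← e]; exact (diag y).1, heq⟩).1
    · have := (diag y).2; have := (diag y').2
      exact absurd (e.symm ▸ (diag y').1 : (τA y', τB y, τC y') ∈ Φ) (h₁ y' y y' (by omega))
  have iC : Function.Injective τC := by
    intro z z' e
    rcases Nat.lt_trichotomy (α z + β z + γ z') K with hlt | heq | hgt
    · exact absurd (e ▸ (diag z).1 : (τA z, τB z, τC z') ∈ Φ) (h₁ z z z' hlt)
    · exact ((h₂ z z z').1 ⟨by rw [← e]; exact (diag z).1, heq⟩).2
    · have := (diag z).2; have := (diag z').2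
      exact absurd (e.symm ▸ (diag z').1 : (τA z', τB z', τC z) ∈ Φ) (h₁ z' z' z (by omega))
  -- the diagonal of image triples
  set T : Fin r → Tr := fun x => (τA x, τB x, τC x) with hT
  have iT : Function.Injective T := fun x x' e => iA (congrArg Prod.fst e)
  set Ψ : Finset Tr := univ.image T with hΨ
  have memΨ : ∀ {t}, t ∈ Ψ ↔ ∃ x, T x = t := by
    intro t; simp [hΨ]
  have hcard : #Ψ = r := by
    rw [hΨ, Finset.card_image_of_injective _ iT, Finset.card_univ, Fintype.card_fin]
  have hsub : Ψ ⊆ Φ := fun t ht => by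
    obtain ⟨x, rfl⟩ := memΨ.mp ht; exact (diag x).1
  have hdiag : isDiagonal Ψ = true := by
    refine decide_eq_true fun t ht t' ht' hlegs => ?_
    obtain ⟨x, rfl⟩ := memΨ.mp ht
    obtain ⟨x', rfl⟩ := memΨ.mp ht'
    rcases hlegs with e | e | e
    · rw [iA e]
    · rw [iB e]
    · rw [iC e]
  -- the weights (defined by extension along the injective leg maps)
  obtain ⟨a, ha, a_off⟩ : ∃ a : Pt → ℤ, (∀ x, a (τA x) = α x) ∧
      ∀ u, (¬ ∃ x, τA x = u) → a u = K + 1 :=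
    ⟨Function.extend τA (fun x => (α x : ℤ)) fun _ => (K : ℤ) + 1,
      fun x => iA.extend_apply _ _ x, fun u h => Function.extend_apply' _ _ u h⟩
  obtain ⟨b, hb, b_off⟩ : ∃ b : Pt → ℤ, (∀ y, b (τB y) = β y) ∧
      ∀ v, (¬ ∃ y, τB y = v) → b v = K + 1 :=
    ⟨Function.extend τB (fun y => (β y : ℤ)) fun _ => (K : ℤ) + 1,
      fun y => iB.extend_apply _ _ y, fun v h => Function.extend_apply' _ _ v h⟩
  obtain ⟨c, hc, c_off⟩ : ∃ c : Pt → ℤ, (∀ z, c (τC z) = (γ z : ℤ) - K) ∧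
      ∀ w, (¬ ∃ z, τC z = w) → c w = 1 :=
    ⟨Function.extend τC (fun z => (γ z : ℤ) - K) fun _ => 1,
      fun z => iC.extend_apply _ _ z, fun w h => Function.extend_apply' _ _ w h⟩
  have a_nonneg : ∀ u, 0 ≤ a u := fun u => by
    by_cases h : ∃ x, τA x = u
    · obtain ⟨x, rfl⟩ := h; rw [ha]; positivity
    · rw [a_off u h]; positivity
  have b_nonneg : ∀ v, 0 ≤ b v := fun v => by
    by_cases h : ∃ y, τB y = v
    · obtain ⟨y, rfl⟩ := h; rw [hb]; positivity
    · rw [b_off v h]; positivity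
  have c_ge : ∀ w, -(K : ℤ) ≤ c w := fun w => by
    by_cases h : ∃ z, τC z = w
    · obtain ⟨z, rfl⟩ := h; rw [hc]; linarith [(γ z).cast_nonneg (α := ℤ)]
    · rw [c_off w h]; omega
  -- `E = 0` on `Ψ`, `E ≥ 1` on `Φ ∖ Ψ`
  have hzero : ∀ t ∈ Ψ, a t.1 + b t.2.1 + c t.2.2 = 0 := fun t ht => by
    obtain ⟨x, rfl⟩ := memΨ.mp ht
    simp only [hT, ha, hb, hc]; have := (diag x).2; omega
  have hone : ∀ t ∈ Φ, t ∉ Ψ → 1 ≤ a t.1 + b t.2.1 + c t.2.2 := by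
    rintro ⟨u, v, w⟩ ht hn
    by_cases hu : ∃ x, τA x = u
    · obtain ⟨x, rfl⟩ := hu
      by_cases hv : ∃ y, τB y = v
      · obtain ⟨y, rfl⟩ := hv
        by_cases hw : ∃ z, τC z = w
        · obtain ⟨z, rfl⟩ := hw
          simp only [ha, hb, hc]
          have hne : α x + β y + γ z ≠ K := fun heq => by
            obtain ⟨rfl, rfl⟩ := (h₂ x y z).1 ⟨ht, heq⟩
            exact hn (memΨ.mpr ⟨x, rfl⟩)
          have hge : ¬ α x + β y + γ z < K := fun hlt => h₁ x y z hlt ht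
          omega
        · simp only [ha, hb, c_off w hw]; omega
      · rw [b_off v hv]; linarith [a_nonneg (τA x), c_ge w]
    · rw [a_off u hu]; linarith [b_nonneg v, c_ge w]
  by_contra hr
  exact noeight Ψ a b c hsub hzero hone hdiag (by omega)

/-! ## §2 The no-go theorems for the tree's monomial certificates -/

/-- **No monomial certificate of `⟨r⟩ ⊴ cw₂^{⊠2}` has `r ≥ 8`.**  The hypotheses are VERBATIM those
of `OutsiderSandwichBorderSubrankTwenty.isApproxRestriction_of_monomial` (the tree's only
degeneration-producing device on CW powers) for host `kroneckerPow (cwTensor F 2) 2` and target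
`unitTensor F r`; conclusion `r ≤ 7`.  [new] -/
theorem cwPow_two_monomial_certificate_le_seven (F : Type) [Field F] {r K : ℕ}
    (σA σB σC : Fin r → Fin 2 → Fin 3) (α β γ : Fin r → ℕ)
    (h₁ : ∀ x y z, α x + β y + γ z < K →
      kroneckerPow (cwTensor F 2) 2 (σA x) (σB y) (σC z) = 0)
    (h₂ : ∀ x y z, (if α x + β y + γ z = K then
      kroneckerPow (cwTensor F 2) 2 (σA x) (σB y) (σC z) else 0) = unitTensor F r x y z) :
    r ≤ 7 := by
  let π : (Fin 2 → Fin 3) → Pt := fun f => (f 0, f 1)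
  refine le_seven_of_frame_certificate (Φ := cwFrame) (K := K)
    (fun Ψ a b c hs hz ho hd h8 => cwFrame_no_diagonal_comb_degeneration_eight hs hz ho hd h8)
    (fun x => π (σA x)) (fun y => π (σB y)) (fun z => π (σC z)) α β γ (fun x y z hlt hmem => ?_)
    (fun x y z => ?_)
  · have h := h₁ x y z hlt
    rw [kroneckerPow_cwTensor_two_apply, if_pos hmem] at h
    exact one_ne_zero h
  · have h := h₂ x y z
    rw [kroneckerPow_cwTensor_two_apply, unitTensor_apply] at h
    constructor
    · rintro ⟨hmem, heq⟩
      rw [if_pos heq, if_pos hmem] at h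
      by_contra hne; rw [if_neg hne] at h; exact one_ne_zero h
    · rintro ⟨rfl, rfl⟩
      rw [if_pos (show x = x ∧ x = x from ⟨rfl, rfl⟩)] at h
      by_cases heq : α x + β x + γ x = K
      · rw [if_pos heq] at h
        by_cases hmem : ((σA x 0, σA x 1), (σB x 0, σB x 1), (σC x 0, σC x 1)) ∈ cwFrame
        · exact ⟨hmem, heq⟩
        · rw [if_neg hmem] at h; exact absurd h zero_ne_one
      · rw [if_neg heq] at h; exact absurd h zero_ne_one

/-- **Nor in the tight frame**: the same for the host `D ⊠ D`, `D a b c = [a, b, c pairwise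
distinct]` (the diagonalised `cw₂`), with leg maps into `Pt = Fin 3 × Fin 3`. [new] -/
theorem diagPow_two_monomial_certificate_le_seven (F : Type) [Field F]
    {D : Fin 3 → Fin 3 → Fin 3 → F} (hD : ∀ a b c, D a b c = if a ≠ b ∧ b ≠ c ∧ a ≠ c then 1 else 0)
    {r K : ℕ} (σA σB σC : Fin r → Pt) (α β γ : Fin r → ℕ)
    (h₁ : ∀ x y z, α x + β y + γ z < K → kroneckerTensor D D (σA x) (σB y) (σC z) = 0)
    (h₂ : ∀ x y z, (if α x + β y + γ z = K then kroneckerTensor D D (σA x) (σB y) (σC z) else 0) =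
      unitTensor F r x y z) : r ≤ 7 := by
  refine le_seven_of_frame_certificate (Φ := tightFrame) (K := K)
    (fun Ψ a b c hs hz ho hd h8 => tightFrame_no_diagonal_comb_degeneration_eight hs hz ho hd h8)
    σA σB σC α β γ (fun x y z hlt hmem => ?_) (fun x y z => ?_)
  · have h := h₁ x y z hlt
    rw [kronecker_diag_apply F hD, if_pos hmem] at h
    exact one_ne_zero h
  · have h := h₂ x y z
    rw [kronecker_diag_apply F hD, unitTensor_apply] at h
    constructor
    · rintro ⟨hmem, heq⟩
      rw [if_pos heq, if_pos hmem] at h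
      by_contra hne; rw [if_neg hne] at h; exact one_ne_zero h
    · rintro ⟨rfl, rfl⟩
      rw [if_pos (show x = x ∧ x = x from ⟨rfl, rfl⟩)] at h
      by_cases heq : α x + β x + γ x = K
      · rw [if_pos heq] at h
        by_cases hmem : (σA x, σB x, σC x) ∈ tightFrame
        · exact ⟨hmem, heq⟩
        · rw [if_neg hmem] at h; exact absurd h zero_ne_one
      · rw [if_neg heq] at h; exact absurd h zero_ne_one

end Summit.MatrixMultiplication.MatrixMultiplication.Theorems.OutsiderSandwichToricCeilingMonomial
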